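import Summits.QuantumFields.BalabanUV.T4Continuum.Support.NE7SliceLetterFourTerm
import Summits.QuantumFields.BalabanUV.T4Continuum.Support.NE7SliceLetterHodgeReductionSplit
import Summits.QuantumFields.BalabanUV.T4Continuum.Support.NE7HessGaugeDir
import Summits.QuantumFields.BalabanUV.T4Continuum.Support.NE7FlatSliceStraightReduction
import Summits.QuantumFields.BalabanUV.T4Continuum.Support.NE3CurvedFrameKill
import Summits.QuantumFields.BalabanUV.T4Continuum.Support.NE3DirIterMajorant
import HarnessLib

/-!
# NE7SliceLetterBalabanGauge — THE END's FOUR-TERM LETTER FOLLOWS FROM A ONE-TERM LETTER ON BAŁABAN's OWN SLICE (the STRAIGHT tangent slice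
# `ker QbarIter_W`, any gauge side condition), A GAUGE-TRANSPORT LETTER (scalar kinematics: how large a gauge parameter moves a contour-tangent field
# into that slice-and-gauge), THE TENSION LETTER AND THE `ℓ¹` FRAME LETTER — tests are transported by CORNER LIFTS of the accumulated frames, the field by
# the gauge parameter, every price is `ad(hol)·λ` or a first-variation (tension) term (file 97 of the curved (APE), F167)

Cell `pub-balaban`, rung (B)+1 sub-cell t4, lineage `b2b-balaban-t4-ne7-p1` (CRUX PROVER NE7 #1 = OWNER of row NE7), generation 83; memo
`t4/b2b-balaban-t4-ne7-p1-g83/BALABAN-GAUGE-ROAD.md` §3.  Over F152 (the four-term shape), F142's re-gauging idioms (`NE7SliceLetterHodgeReductionSplit`), the tension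
identities `NE7HessGaugeDirLeftGeneral.hess_gaugeDir_left` (gauge direction in the FIRST slot) and `NE7HessGaugeDir.hess_gaugeDir_eq` (SECOND slot), row NE3's structure
theorem `NE3TangentCovariantTower.dirIter_eq_QbarIter_add_gaugeDir` (`dirIter = QbarIter + gaugeDir_c ∘ framePotW`), `dirIter_add_gaugeDir`, `NE3CurvedFrameKill.framePotW_skew_periodic`,
lineage #2's `NE7FlatSliceStraightReduction.cornerLift`, and `NE3CurlOfGaugeDir.norm_curlAt_gaugeDir_le` (`‖curl_W(D_Wλ)‖ ≤ 2x‖λ‖`) BY NAME.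
WHY.  Gen 83's power counting (memo §1) kills gen 82's P2 soft operator: the CONTOUR mass `M⁻²·dirIter^*dirIter` is not `ℓ^∞`-bounded uniformly (`dirIter^*` concentrates
coarse divergences on the hierarchical contour bonds with multiplicity `(M∕L)^d`), and a straight mass with the contour constraint has a mismatch of curl size `≍ K₁R∕M`
without class smallness.  Print's way ([B5] §C, [B9] §3) is to work on the STRAIGHT slice in the projected (block-Landau) gauge, where the soft transfer is ONE-TERM
(F166 `NE7ConstrainedGreenBalabanGauge.eq_source_of_gaugeFixed`).  THIS file is the kinematic half of that road, kernel-checked: it moves the END's contour-tangent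
field `X` by a gauge parameter `λ` (supplied with its size by the displayed TRANSPORT letter) onto Bałaban's slice, moves every straight-tangent TEST back onto the
contour slice by the corner lift of MINUS its accumulated frames (exact: `dirIter(Y + D_W cornerLift(−framePotW Y)) = 0`), prices the two moves by the tension letter
(`|dS_W(K)| ≤ τ_W‖K‖₁`) and the `ℓ¹` frame letter (`Σ_z ‖framePotW Y z‖ ≤ C_fr‖Y‖₁`), and the field's move by `‖curl_W(D_Wλ)‖ ≤ 2x‖λ‖`.  RESULT: the END's `h4`
(F152∕F165 shape) with `K_G = K_B(1 + 2dC_fr)`, `K_X = 2dK_BC_frτ_W + A·C_R`, `K_D = A·C_D`, `K_Ξ = A·C_Ξ`, `A = 2K_Bτ_W(1 + 4dC_fr) + 2x` — power counting (memo §3):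
`K_B ≍ K₁M`, `τ_W ≍ c∕M³`, `C_R ≍ M`, `C_D ≍ M²`, `C_Ξ ≍ 1` ⟹ `K_X ≍ (b + K₁c)∕M`, `K_D ≍ b + K₁c` (class-small), `K_Ξ ≍ (b + K₁c)∕M²`.
WHAT ([folklore]; 0 def, 0 sorry).  §1 kinematic helpers (`isSkewDir_add`, `isPeriodicDir_add'`, `sum_norm_cornerLift_eq`, `dirL1_gaugeDir_cornerLift_le`,
`gaugeDir_neg_pi`, `dirIter_testLift_eq_zero` — THE TEST TRANSPORT IS EXACT); §2 **`fourTermLetter_of_balabanSlice`**.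
HONEST FRAMING (page 1): bookkeeping∕kinematics; the ONE-TERM letter on Bałaban's slice (`hB`: [B9] Thm 3.3 TYPE — the curl row of Bałaban's constrained propagator at
curved `W`; NE9's rows in their window), the TRANSPORT letter (`hT`: scalar rows — prescribed-block-mean harmonic extension and the block-mean-zero covariant Poisson problem,
(H0_W) TYPE), the tension letter (`hten`, F141 discharges it from the flux-gradient radius) and the frame letter (`hfr`, flat: lineage #2's `sum_norm_framePot_le`) are DISPLAYED
HYPOTHESES; nothing of Bałaban's asserted; (APE) on curved data NOT proved; NOT ONE-STEP, NOT NE7; spine 0∕9; finite T⁴ rung (B)+1 — NOT infinite volume, NOT mass gap, NOT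
`BetaPertH`, NOT Clay.  Continuum YM on T⁴ ⇐ BetaPertH ∧ nine spine estimates (0/9 proved); BetaPertH ⇐ (D1) ∧ (D4) ∧ CAP+tail; G-an2-4 gates asym, D1 and NE2/3/4.
-/

set_option autoImplicit false

open scoped BigOperators Matrix Matrix.Norms.L2Operator
open NormedSpace Finset

namespace Summit.QuantumFields.BalabanUV.T4Continuum.NE7SliceLetterBalabanGauge

open Literature.MathematicalPhysics.QuantumFieldTheory.Balaban1983to89
open B7Prop1Explicit B7Prop2Explicit UnitaryModel
open T4AveragingDeficitWall (Ad IsUnitaryCfg IsSkewDir SmallField curlAt dirL1)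
open T4AveragingDeficitWallBoundary (IsPeriodicCfg periodBox mem_periodBox sum_periodBox_shift)
open AveragingDeficitPeriodicCounting (IsPeriodicDir)
open AveragingDeficitMultiLevelPrep (cavgIter tower LevelSmall)
open AveragingDeficitTransport (norm_Ad_of_unitary Ad_mem_skewAdjoint)
open AveragingDeficitNearIdentity (Ad_neg)
open MinimalActionLevels (perWin)
open BlockAveragePushDirGauge (gaugeDir isPeriodicDir_gaugeDir)
open NE3HessForm (hess dAction)
open NE3TangentCovariantTower (dirIter QbarIter framePotW dirIter_add_gaugeDir dirIter_eq_QbarIter_add_gaugeDir)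
open NE3CovariantWeitzenbock (covDiv)
open NE3EnergyHessBilin (hess_add_left hess_add_right curlAt_add)
open NE3CurlOfGaugeDir (norm_curlAt_gaugeDir_le)
open NE3ProductPath (commutator_mem_skewAdjoint)
open NE3BlockLineAverage (sum_periodBox_blocks)
open NE3CurvedFrameKill (framePotW_skew_periodic pow_succ_mul_eq_tower)
open NE3FramePotBoundW (tower_eq_pow_mul)
open NE3DirIterMajorant (norm_gaugeDir_le)
open NE7ExactCurrent (isSkewDir_gaugeDir)
open NE7HessGaugeDirLeftGeneral (hess_gaugeDir_left)
open NE7HessGaugeDirLeft (isSkewDir_commDir isPeriodicDir_commDir)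
open NE7HessGaugeDir (hess_gaugeDir_eq)
open NE7SliceLetterHodgeReduction (dirL1_commDir_le)
open NE7FlatSliceStraightReduction (cornerLift cornerLift_corner cornerLift_off_corner cornerLift_add_period cornerLift_mem_skewAdjoint)

noncomputable section

variable {d : ℕ} {n : Type*} [Fintype n] [DecidableEq n]

/-! ## §1 Kinematic helpers -/

omit [Fintype n] [DecidableEq n] in
/-- Sums of skew direction fields are skew. [folklore] -/
theorem isSkewDir_add {X Y : Site d → Fin d → Matrix n n ℂ} (hX : IsSkewDir X) (hY : IsSkewDir Y) : IsSkewDir (fun y κ => X y κ + Y y κ) :=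
  fun y κ => (skewAdjoint (Matrix n n ℂ)).add_mem (hX y κ) (hY y κ)

omit [Fintype n] [DecidableEq n] in
/-- Sums of `P`-periodic direction fields are `P`-periodic. [folklore] -/
theorem isPeriodicDir_add' {X Y : Site d → Fin d → Matrix n n ℂ} {P : ℤ} (hX : IsPeriodicDir X P) (hY : IsPeriodicDir Y P) :
    IsPeriodicDir (fun y κ => X y κ + Y y κ) P :=
  fun y i κ => by simp only [hX y i κ, hY y i κ]

/-- **THE CORNER LIFT's `ℓ¹` MASS SITS AT THE CORNERS**: `Σ_{x ∈ periodBox (M·N)} ‖cornerLift M F x‖ = Σ_{z ∈ periodBox N} ‖F z‖` (`M ≥ 1`). [folklore] -/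
theorem sum_norm_cornerLift_eq {M N : ℕ} (hM : 1 ≤ M) (F : Site d → Matrix n n ℂ) :
    ∑ x ∈ periodBox (d := d) (M * N), ‖cornerLift M F x‖ = ∑ z ∈ periodBox (d := d) N, ‖F z‖ := by
  rw [← sum_periodBox_blocks M N hM (fun x => ‖cornerLift M F x‖)]
  refine Finset.sum_congr rfl fun z _ => ?_
  rw [Finset.sum_eq_single_of_mem (0 : Site d)
    (mem_periodBox.mpr fun κ => ⟨le_rfl, by simp only [Pi.zero_apply]; exact_mod_cast (by omega : 0 < M)⟩)
    (fun v hv hv0 => by rw [cornerLift_off_corner M F z hv hv0, norm_zero])]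
  rw [add_zero, cornerLift_corner hM]

/-- **THE `ℓ¹` COST OF RE-GAUGING A TEST BY A CORNER LIFT**: for unitary `W` and an `N`-periodic coarse `F`,
`‖gaugeDir W (cornerLift M F)‖_{ℓ¹(periodBox (M·N))} ≤ 2d·Σ_{z ∈ periodBox N} ‖F z‖`. [folklore] -/
theorem dirL1_gaugeDir_cornerLift_le {M N : ℕ} (hM : 1 ≤ M) (hN : 1 ≤ N) {W : Site d → Fin d → (Matrix n n ℂ)ˣ} (hWu : IsUnitaryCfg W) {F : Site d → Matrix n n ℂ}
    (hF : ∀ (z : Site d) (τ : Fin d), F (z + (N : ℤ) • e τ) = F z) :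
    dirL1 (gaugeDir W (cornerLift M F)) (periodBox (d := d) (M * N)) ≤ 2 * d * ∑ z ∈ periodBox (d := d) N, ‖F z‖ := by
  have hMN : 1 ≤ M * N := hN.trans (Nat.le_mul_of_pos_left N (by omega))
  have hper : ∀ (x : Site d) (κ : Fin d), ‖cornerLift M F (x + ((M * N : ℕ) : ℤ) • e κ)‖ = ‖cornerLift M F x‖ := by
    intro x κ
    rw [show ((M * N : ℕ) : ℤ) = (M : ℤ) * (N : ℤ) by push_cast; ring, cornerLift_add_period hM hF]
  unfold T4AveragingDeficitWall.dirL1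
  calc ∑ x ∈ periodBox (d := d) (M * N), ∑ κ : Fin d, ‖gaugeDir W (cornerLift M F) x κ‖
      ≤ ∑ x ∈ periodBox (d := d) (M * N), ∑ κ : Fin d, (‖cornerLift M F x‖ + ‖cornerLift M F (x + e κ)‖) :=
        Finset.sum_le_sum fun x _ => Finset.sum_le_sum fun κ _ => norm_gaugeDir_le hWu _ x κ
    _ = ∑ κ : Fin d, (∑ x ∈ periodBox (d := d) (M * N), ‖cornerLift M F x‖ + ∑ x ∈ periodBox (d := d) (M * N), ‖cornerLift M F (x + e κ)‖) := by
        rw [Finset.sum_comm]; simp only [Finset.sum_add_distrib]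
    _ = ∑ _κ : Fin d, 2 * ∑ z ∈ periodBox (d := d) N, ‖F z‖ := by
        refine Finset.sum_congr rfl fun κ _ => ?_
        rw [sum_periodBox_shift (M * N) hMN (g := fun x => ‖cornerLift M F x‖) hper (e κ), sum_norm_cornerLift_eq hM]; ring
    _ = 2 * d * ∑ z ∈ periodBox (d := d) N, ‖F z‖ := by
        rw [Finset.sum_const, Finset.card_univ, Fintype.card_fin, nsmul_eq_mul]; ring

/-- `gaugeDir V (−Φ) = −gaugeDir V Φ` pointwise. [folklore] -/
theorem gaugeDir_neg_pi (V : Site d → Fin d → (Matrix n n ℂ)ˣ) (Φ : Site d → Matrix n n ℂ) (x : Site d) (μ : Fin d) :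
    gaugeDir V (fun y => -Φ y) x μ = -gaugeDir V Φ x μ := by
  simp only [BlockAveragePushDirGauge.gaugeDir, Ad_neg]; abel

/-- **THE TEST TRANSPORT IS EXACT**: in the multi-level small-field class, for a skew periodic STRAIGHT-tangent test `Y` (`QbarIter L (j+1) W Y = 0`) the corner lift
`ν := cornerLift (L^{j+1}) (−framePotW L (j+1) W Y)` moves it onto the CONTOUR-tangent slice: `dirIter L (j+1) W (Y + gaugeDir W ν) = 0` — the lift's corner values
cancel the accumulated frames (`dirIter = QbarIter + gaugeDir_c ∘ framePotW`, `dirIter (gaugeDir W ν) = gaugeDir_c (ν ∘ corner)`). [folklore] -/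
theorem dirIter_testLift_eq_zero [Nonempty n] {L N : ℕ} [NeZero N] (hL : 1 ≤ L) (j : ℕ)
    {W : Site d → Fin d → (Matrix n n ℂ)ˣ} {x : ℝ} (hWu : IsUnitaryCfg W) (hWP : IsPeriodicCfg W ((tower L N (j + 1) : ℕ) : ℤ))
    (hx : 0 ≤ x) (hs : LevelSmall d L j x) (hWx : SmallField W x)
    {Y : Site d → Fin d → Matrix n n ℂ} (hY : IsSkewDir Y) (hYP : IsPeriodicDir Y ((tower L N (j + 1) : ℕ) : ℤ)) (hYQ : QbarIter L (j + 1) W Y = 0)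
    {ν : Site d → Matrix n n ℂ} (hν : ν = cornerLift (L ^ (j + 1)) (fun z => -framePotW L (j + 1) W Y z))
    (hνs : ∀ y, ν y ∈ skewAdjoint (Matrix n n ℂ)) (hνP : ∀ (y : Site d) (i : Fin d), ν (y + ((tower L N (j + 1) : ℕ) : ℤ) • e i) = ν y) :
    dirIter L (j + 1) W (fun y κ => Y y κ + gaugeDir W ν y κ) = 0 := by
  rw [dirIter_add_gaugeDir hL j hWu hWP hx hs hWx Y hνs hνP, dirIter_eq_QbarIter_add_gaugeDir hL j hWu hWP hx hs hWx hY hYP, hYQ]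
  have hM1 : 1 ≤ L ^ (j + 1) := Nat.one_le_pow _ _ hL
  have hcorner : (fun y => ν (((L : ℤ) ^ (j + 1)) • y)) = fun y => -framePotW L (j + 1) W Y y := by
    funext y
    rw [hν, show ((L : ℤ) ^ (j + 1)) = ((L ^ (j + 1) : ℕ) : ℤ) by push_cast; ring, cornerLift_corner hM1]
  funext z κ
  rw [hcorner, gaugeDir_neg_pi]
  simp

/-! ## §2 The reduction: four-term letter ⟸ one-term letter on Bałaban's slice + transport + tension + frames -/

/-- **THE END's FOUR-TERM LETTER FROM A ONE-TERM LETTER ON BAŁABAN's SLICE.**  Data: `L ≥ 1`, `N`, `j`, `P = N·L^{j+1} ≥ 2`, `M = L^{j+1}`; `W` unitary `P`-periodic in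
the multi-level small-field class (`LevelSmall d L j x`, `SmallField W x`); an ARBITRARY gauge side condition `Gauge` (Bałaban's: covariant divergence blockwise-constant).
DISPLAYED LETTERS: `hten` — `|dAction W K (perWin d P)| ≤ τ_W‖K‖_{ℓ¹(periodBox P)}` for skew `P`-periodic `K`; `hfr` — `Σ_{z ∈ periodBox N} ‖framePotW L (j+1) W Y z‖ ≤
C_fr‖Y‖_{ℓ¹(periodBox P)}` for skew `P`-periodic straight-tangent `Y`; `hB` — THE ONE-TERM LETTER ON BAŁABAN's SLICE: for skew `P`-periodic `X″` with `QbarIter L (j+1) W X″ = 0` and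
`Gauge X″`, `‖curl_W X″‖ ≤ K_B·g″` whenever `|hess W X″ Y| ≤ g″‖Y‖₁` on the skew `P`-periodic straight-tangent tests; `hT` — THE TRANSPORT LETTER: every skew `P`-periodic
contour-tangent `X` with every skew `P`-periodic `σ` is moved by some skew `P`-periodic `λ` onto that slice-and-gauge, `‖λ‖_∞ ≤ C_R·R + C_Ξ·Ξ + C_D·D` in terms of `‖X‖_∞ ≤ R`,
`‖σ‖_∞ ≤ Ξ`, `‖covDiv W (X + gaugeDir W σ)‖_∞ ≤ D`.  THEN the four-term letter (F152's shape) holds on the contour slice with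
`K_G = K_B(1 + 2dC_fr)`, `K_X = 2dK_BC_frτ_W + A·C_R`, `K_D = A·C_D`, `K_Ξ = A·C_Ξ`, `A = 2K_Bτ_W(1 + 4dC_fr) + 2x`. [folklore] -/
theorem fourTermLetter_of_balabanSlice [Nonempty n] {L N : ℕ} [NeZero N] (hL : 1 ≤ L) (j : ℕ) (hP : 2 ≤ N * L ^ (j + 1))
    {W : Site d → Fin d → (Matrix n n ℂ)ˣ} {x : ℝ} (hWu : IsUnitaryCfg W) (hWP : IsPeriodicCfg W ((N * L ^ (j + 1) : ℕ) : ℤ))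
    (hx : 0 ≤ x) (hs : LevelSmall d L j x) (hWx : SmallField W x)
    -- the tension letter and the `ℓ¹` frame letter
    {τW : ℝ} (hτ : 0 ≤ τW)
    (hten : ∀ K : Site d → Fin d → Matrix n n ℂ, IsSkewDir K → IsPeriodicDir K ((N * L ^ (j + 1) : ℕ) : ℤ) →
      |dAction W K (perWin d (N * L ^ (j + 1)))| ≤ τW * dirL1 K (periodBox (d := d) (N * L ^ (j + 1))))
    {Cfr : ℝ} (hCfr : 0 ≤ Cfr)
    (hfr : ∀ Y : Site d → Fin d → Matrix n n ℂ, IsSkewDir Y → IsPeriodicDir Y ((N * L ^ (j + 1) : ℕ) : ℤ) → QbarIter L (j + 1) W Y = 0 →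
      ∑ z ∈ periodBox (d := d) N, ‖framePotW L (j + 1) W Y z‖ ≤ Cfr * dirL1 Y (periodBox (d := d) (N * L ^ (j + 1))))
    -- the one-term letter on Bałaban's slice, with an arbitrary gauge side condition
    (Gauge : (Site d → Fin d → Matrix n n ℂ) → Prop) {KB : ℝ}
    (hB : ∀ X'' : Site d → Fin d → Matrix n n ℂ, IsSkewDir X'' → IsPeriodicDir X'' ((N * L ^ (j + 1) : ℕ) : ℤ) → QbarIter L (j + 1) W X'' = 0 → Gauge X'' →
      ∀ g'' : ℝ, 0 ≤ g'' →
      (∀ Y : Site d → Fin d → Matrix n n ℂ, IsSkewDir Y → IsPeriodicDir Y ((N * L ^ (j + 1) : ℕ) : ℤ) → QbarIter L (j + 1) W Y = 0 →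
        |hess W X'' Y (perWin d (N * L ^ (j + 1)))| ≤ g'' * dirL1 Y (periodBox (d := d) (N * L ^ (j + 1)))) →
      ∀ z μ' ν', μ' ≠ ν' → ‖curlAt W X'' z μ' ν'‖ ≤ KB * g'')
    -- the transport letter
    {CR CΞ CD : ℝ}
    (hT : ∀ X : Site d → Fin d → Matrix n n ℂ, IsSkewDir X → IsPeriodicDir X ((N * L ^ (j + 1) : ℕ) : ℤ) → dirIter L (j + 1) W X = 0 →
      ∀ σ : Site d → Matrix n n ℂ, (∀ y, σ y ∈ skewAdjoint (Matrix n n ℂ)) → (∀ (y : Site d) (i : Fin d), σ (y + ((N * L ^ (j + 1) : ℕ) : ℤ) • e i) = σ y) →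
      ∀ R : ℝ, (∀ y κ', ‖X y κ'‖ ≤ R) → ∀ Ξ : ℝ, (∀ y, ‖σ y‖ ≤ Ξ) →
      ∀ D : ℝ, (∀ y, ‖covDiv W (fun z κ => X z κ + gaugeDir W σ z κ) y‖ ≤ D) →
      ∃ lam : Site d → Matrix n n ℂ, (∀ y, lam y ∈ skewAdjoint (Matrix n n ℂ)) ∧ (∀ (y : Site d) (i : Fin d), lam (y + ((N * L ^ (j + 1) : ℕ) : ℤ) • e i) = lam y) ∧
        QbarIter L (j + 1) W (fun y κ => X y κ + gaugeDir W lam y κ) = 0 ∧ Gauge (fun y κ => X y κ + gaugeDir W lam y κ) ∧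
        ∀ y, ‖lam y‖ ≤ CR * R + CΞ * Ξ + CD * D) :
    ∀ X : Site d → Fin d → Matrix n n ℂ, IsSkewDir X →
      IsPeriodicDir X ((N * L ^ (j + 1) : ℕ) : ℤ) → dirIter L (j + 1) W X = 0 → ∀ R : ℝ, (∀ y κ', ‖X y κ'‖ ≤ R) → ∀ g : ℝ, 0 ≤ g →
      (∀ Y : Site d → Fin d → Matrix n n ℂ, IsSkewDir Y → IsPeriodicDir Y ((N * L ^ (j + 1) : ℕ) : ℤ) → dirIter L (j + 1) W Y = 0 →
        |hess W X Y (perWin d (N * L ^ (j + 1)))| ≤ g * dirL1 Y (periodBox (d := d) (N * L ^ (j + 1)))) →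
      ∀ σ : Site d → Matrix n n ℂ, (∀ y, σ y ∈ skewAdjoint (Matrix n n ℂ)) →
      (∀ (y : Site d) (i : Fin d), σ (y + ((N * L ^ (j + 1) : ℕ) : ℤ) • e i) = σ y) → ∀ Ξ : ℝ, (∀ y, ‖σ y‖ ≤ Ξ) →
      ∀ D : ℝ, (∀ y, ‖covDiv W (fun z κ => X z κ + gaugeDir W σ z κ) y‖ ≤ D) →
      ∀ z μ' ν', μ' ≠ ν' → ‖curlAt W X z μ' ν'‖
        ≤ (KB * (1 + 2 * d * Cfr)) * g + (2 * d * KB * Cfr * τW + (2 * KB * τW * (1 + 4 * d * Cfr) + 2 * x) * CR) * R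
          + ((2 * KB * τW * (1 + 4 * d * Cfr) + 2 * x) * CD) * D + ((2 * KB * τW * (1 + 4 * d * Cfr) + 2 * x) * CΞ) * Ξ := by
  intro X hXs hXP hXT R hR g hg hfun σ hσs hσP Ξ hσΞ D hD z μ' ν' hne
  -- periods: `tower L N (j+1) = N·L^{j+1}`
  have htow : (tower L N (j + 1) : ℕ) = N * L ^ (j + 1) := by rw [tower_eq_pow_mul, Nat.mul_comm]
  have hWP' : IsPeriodicCfg W ((tower L N (j + 1) : ℕ) : ℤ) := by rw [htow]; exact hWP
  have hM1 : 1 ≤ L ^ (j + 1) := Nat.one_le_pow _ _ hL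
  have hN1 : 1 ≤ N := Nat.one_le_iff_ne_zero.mpr (NeZero.ne N)
  have hR0 : 0 ≤ R := (norm_nonneg _).trans (hR z μ')
  -- the transport
  obtain ⟨lam, hlams, hlamP, hQ'', hG'', hlamB⟩ := hT X hXs hXP hXT σ hσs hσP R hR Ξ hσΞ D hD
  set Λ : ℝ := CR * R + CΞ * Ξ + CD * D with hΛdef
  have hΛ0 : 0 ≤ Λ := (norm_nonneg _).trans (hlamB 0)
  set G : Site d → Fin d → Matrix n n ℂ := gaugeDir W lam with hGdef
  set X'' : Site d → Fin d → Matrix n n ℂ := fun y κ => X y κ + G y κ with hX''def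
  have hGs : IsSkewDir G := isSkewDir_gaugeDir hWu hlams
  have hGP : IsPeriodicDir G ((N * L ^ (j + 1) : ℕ) : ℤ) := isPeriodicDir_gaugeDir hWP hlamP
  have hX''s : IsSkewDir X'' := isSkewDir_add hXs hGs
  have hX''P : IsPeriodicDir X'' ((N * L ^ (j + 1) : ℕ) : ℤ) := isPeriodicDir_add' hXP hGP
  have hGsup : ∀ y κ', ‖G y κ'‖ ≤ 2 * Λ := fun y κ' =>
    (norm_gaugeDir_le hWu lam y κ').trans (by linarith [hlamB y, hlamB (y + e κ')])
  have hX''sup : ∀ y κ', ‖X'' y κ'‖ ≤ R + 2 * Λ := fun y κ' =>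
    (norm_add_le _ _).trans (add_le_add (hR y κ') (hGsup y κ'))
  -- the functional of `X''` on the STRAIGHT-tangent tests
  set g'' : ℝ := (g + 2 * τW * Λ) * (1 + 2 * d * Cfr) + 2 * d * Cfr * τW * (R + 2 * Λ) with hg''def
  have hg''0 : 0 ≤ g'' := by positivity
  have hfun'' : ∀ Y : Site d → Fin d → Matrix n n ℂ, IsSkewDir Y → IsPeriodicDir Y ((N * L ^ (j + 1) : ℕ) : ℤ) → QbarIter L (j + 1) W Y = 0 →
      |hess W X'' Y (perWin d (N * L ^ (j + 1)))| ≤ g'' * dirL1 Y (periodBox (d := d) (N * L ^ (j + 1))) := by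
    intro Y hY hYP hYQ
    have hYP' : IsPeriodicDir Y ((tower L N (j + 1) : ℕ) : ℤ) := by rw [htow]; exact hYP
    -- the accumulated frames of `Y` and their corner lift
    obtain ⟨hθs, hθP⟩ := framePotW_skew_periodic hL j hWu hWP' hx hs hWx hY hYP'
    set θ : Site d → Matrix n n ℂ := framePotW L (j + 1) W Y with hθdef
    set ν : Site d → Matrix n n ℂ := cornerLift (L ^ (j + 1)) (fun w => -θ w) with hνdef
    have hnθs : ∀ w, -θ w ∈ skewAdjoint (Matrix n n ℂ) := fun w => (skewAdjoint (Matrix n n ℂ)).neg_mem (hθs w)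
    have hnθP : ∀ (w : Site d) (τ : Fin d), -θ (w + (N : ℤ) • e τ) = -θ w := fun w τ => by rw [hθP w τ]
    have hνs : ∀ y, ν y ∈ skewAdjoint (Matrix n n ℂ) := fun y => cornerLift_mem_skewAdjoint _ hnθs y
    have hνP : ∀ (y : Site d) (i : Fin d), ν (y + ((N * L ^ (j + 1) : ℕ) : ℤ) • e i) = ν y := by
      intro y i
      rw [show ((N * L ^ (j + 1) : ℕ) : ℤ) = ((L ^ (j + 1) : ℕ) : ℤ) * (N : ℤ) by push_cast; ring]
      exact cornerLift_add_period hM1 hnθP y i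
    have hνP' : ∀ (y : Site d) (i : Fin d), ν (y + ((tower L N (j + 1) : ℕ) : ℤ) • e i) = ν y := by rw [htow]; exact hνP
    -- the moved test `Y♮ = Y + gaugeDir W ν` is CONTOUR-tangent
    set Gν : Site d → Fin d → Matrix n n ℂ := gaugeDir W ν with hGνdef
    set Yn : Site d → Fin d → Matrix n n ℂ := fun y κ => Y y κ + Gν y κ with hYndef
    have hGνs : IsSkewDir Gν := isSkewDir_gaugeDir hWu hνs
    have hGνP : IsPeriodicDir Gν ((N * L ^ (j + 1) : ℕ) : ℤ) := isPeriodicDir_gaugeDir hWP hνP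
    have hYns : IsSkewDir Yn := isSkewDir_add hY hGνs
    have hYnP : IsPeriodicDir Yn ((N * L ^ (j + 1) : ℕ) : ℤ) := isPeriodicDir_add' hYP hGνP
    have hYnT : dirIter L (j + 1) W Yn = 0 := dirIter_testLift_eq_zero hL j hWu hWP' hx hs hWx hY hYP' hYQ hνdef hνs hνP'
    -- `ℓ¹` sizes
    have hY1 : 0 ≤ dirL1 Y (periodBox (d := d) (N * L ^ (j + 1))) := by
      unfold T4AveragingDeficitWall.dirL1; exact Finset.sum_nonneg fun _ _ => Finset.sum_nonneg fun _ _ => norm_nonneg _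
    have hSθ : ∑ w ∈ periodBox (d := d) N, ‖-θ w‖ ≤ Cfr * dirL1 Y (periodBox (d := d) (N * L ^ (j + 1))) := by
      simp only [norm_neg]; exact hfr Y hY hYP hYQ
    have hGν1 : dirL1 Gν (periodBox (d := d) (N * L ^ (j + 1))) ≤ 2 * d * (Cfr * dirL1 Y (periodBox (d := d) (N * L ^ (j + 1)))) := by
      have h := dirL1_gaugeDir_cornerLift_le (M := L ^ (j + 1)) (F := fun w => -θ w) hM1 hN1 hWu hnθP
      rw [show L ^ (j + 1) * N = N * L ^ (j + 1) from Nat.mul_comm _ _] at h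
      exact h.trans (mul_le_mul_of_nonneg_left hSθ (by positivity))
    have hYn1 : dirL1 Yn (periodBox (d := d) (N * L ^ (j + 1))) ≤ (1 + 2 * d * Cfr) * dirL1 Y (periodBox (d := d) (N * L ^ (j + 1))) := by
      have hsplit : Yn = Y + Gν := by funext y κ; simp [hYndef]
      rw [hsplit]
      exact (NE3LiftDefectCorrection.dirL1_add_le Y Gν _).trans (by nlinarith [hGν1])
    have hν1 : ∑ y ∈ periodBox (d := d) (N * L ^ (j + 1)), ‖ν y‖ ≤ Cfr * dirL1 Y (periodBox (d := d) (N * L ^ (j + 1))) := by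
      rw [hνdef, show N * L ^ (j + 1) = L ^ (j + 1) * N from Nat.mul_comm _ _, sum_norm_cornerLift_eq hM1]
      rw [show L ^ (j + 1) * N = N * L ^ (j + 1) from Nat.mul_comm _ _] 
      exact hSθ
    -- (t1)+(t2): the functional of `X'' = X + G` on the contour-tangent `Yn`
    have hsplitX : X'' = X + G := by funext y κ; simp [hX''def]
    have ht1 : |hess W X Yn (perWin d (N * L ^ (j + 1)))| ≤ g * ((1 + 2 * d * Cfr) * dirL1 Y (periodBox (d := d) (N * L ^ (j + 1)))) :=
      (hfun Yn hYns hYnP hYnT).trans (mul_le_mul_of_nonneg_left hYn1 hg)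
    have ht2 : |hess W G Yn (perWin d (N * L ^ (j + 1)))| ≤ τW * (2 * Λ * ((1 + 2 * d * Cfr) * dirL1 Y (periodBox (d := d) (N * L ^ (j + 1))))) := by
      rw [hGdef, hess_gaugeDir_left hP W hlamP Yn _]
      refine (hten _ (isSkewDir_commDir hlams hYns) (isPeriodicDir_commDir hlamP hYnP)).trans (mul_le_mul_of_nonneg_left ?_ hτ)
      exact (dirL1_commDir_le lam Yn hlamB _).trans (mul_le_mul_of_nonneg_left hYn1 (by positivity))
    -- (t3): the second-slot gauge contamination `hess W X'' (gaugeDir W ν)`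
    have ht3 : |hess W X'' Gν (perWin d (N * L ^ (j + 1)))| ≤ τW * (2 * (R + 2 * Λ) * (d * (Cfr * dirL1 Y (periodBox (d := d) (N * L ^ (j + 1)))))) := by
      rw [hGνdef, hess_gaugeDir_eq W X'' ν _, abs_neg]
      have hKs : IsSkewDir (fun y κ => Ad (W y κ)⁻¹ (ν y) * X'' y κ - X'' y κ * Ad (W y κ)⁻¹ (ν y)) := fun y κ =>
        commutator_mem_skewAdjoint (Ad_mem_skewAdjoint ((unitaryUnits (Matrix n n ℂ)).inv_mem (hWu y κ)) (hνs y)) (hX''s y κ)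
      have hKP : IsPeriodicDir (fun y κ => Ad (W y κ)⁻¹ (ν y) * X'' y κ - X'' y κ * Ad (W y κ)⁻¹ (ν y)) ((N * L ^ (j + 1) : ℕ) : ℤ) := by
        intro y i κ
        simp only [hWP y i κ, hνP y i, hX''P y i κ]
      refine (hten _ hKs hKP).trans (mul_le_mul_of_nonneg_left ?_ hτ)
      unfold T4AveragingDeficitWall.dirL1
      calc ∑ y ∈ periodBox (d := d) (N * L ^ (j + 1)), ∑ κ : Fin d, ‖Ad (W y κ)⁻¹ (ν y) * X'' y κ - X'' y κ * Ad (W y κ)⁻¹ (ν y)‖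
          ≤ ∑ y ∈ periodBox (d := d) (N * L ^ (j + 1)), ∑ _κ : Fin d, 2 * (R + 2 * Λ) * ‖ν y‖ := by
            refine Finset.sum_le_sum fun y _ => Finset.sum_le_sum fun κ _ => ?_
            have hA : ‖Ad (W y κ)⁻¹ (ν y)‖ = ‖ν y‖ := norm_Ad_of_unitary ((unitaryUnits (Matrix n n ℂ)).inv_mem (hWu y κ)) _
            calc ‖Ad (W y κ)⁻¹ (ν y) * X'' y κ - X'' y κ * Ad (W y κ)⁻¹ (ν y)‖
                ≤ ‖Ad (W y κ)⁻¹ (ν y) * X'' y κ‖ + ‖X'' y κ * Ad (W y κ)⁻¹ (ν y)‖ := norm_sub_le _ _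
              _ ≤ ‖Ad (W y κ)⁻¹ (ν y)‖ * ‖X'' y κ‖ + ‖X'' y κ‖ * ‖Ad (W y κ)⁻¹ (ν y)‖ := add_le_add (norm_mul_le _ _) (norm_mul_le _ _)
              _ ≤ ‖ν y‖ * (R + 2 * Λ) + (R + 2 * Λ) * ‖ν y‖ := by
                  rw [hA]; exact add_le_add (mul_le_mul_of_nonneg_left (hX''sup y κ) (norm_nonneg _))
                    (mul_le_mul_of_nonneg_right (hX''sup y κ) (norm_nonneg _))
              _ = 2 * (R + 2 * Λ) * ‖ν y‖ := by ring
        _ = 2 * (R + 2 * Λ) * (d * ∑ y ∈ periodBox (d := d) (N * L ^ (j + 1)), ‖ν y‖) := by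
            rw [Finset.mul_sum, Finset.mul_sum]
            refine Finset.sum_congr rfl fun y _ => ?_
            rw [Finset.sum_const, Finset.card_univ, Fintype.card_fin, nsmul_eq_mul]; ring
        _ ≤ 2 * (R + 2 * Λ) * (d * (Cfr * dirL1 Y (periodBox (d := d) (N * L ^ (j + 1))))) :=
            mul_le_mul_of_nonneg_left (mul_le_mul_of_nonneg_left hν1 (by positivity)) (by positivity)
    -- assemble: `hess W X'' Y = hess W X Yn + hess W G Yn − hess W X'' Gν`
    have heq : hess W X'' Y (perWin d (N * L ^ (j + 1)))
        = hess W X Yn (perWin d (N * L ^ (j + 1))) + hess W G Yn (perWin d (N * L ^ (j + 1))) - hess W X'' Gν (perWin d (N * L ^ (j + 1))) := by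
      have hsplitY : Yn = Y + Gν := by funext y κ; simp [hYndef]
      have h1 : hess W X'' Yn (perWin d (N * L ^ (j + 1))) = hess W X'' Y (perWin d (N * L ^ (j + 1))) + hess W X'' Gν (perWin d (N * L ^ (j + 1))) := by
        rw [hsplitY, hess_add_right]
      have h2 : hess W X'' Yn (perWin d (N * L ^ (j + 1))) = hess W X Yn (perWin d (N * L ^ (j + 1))) + hess W G Yn (perWin d (N * L ^ (j + 1))) := by
        rw [hsplitX, hess_add_left]
      linarith
    rw [heq]
    calc |hess W X Yn (perWin d (N * L ^ (j + 1))) + hess W G Yn (perWin d (N * L ^ (j + 1))) - hess W X'' Gν (perWin d (N * L ^ (j + 1)))|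
        ≤ |hess W X Yn (perWin d (N * L ^ (j + 1)))| + |hess W G Yn (perWin d (N * L ^ (j + 1)))| + |hess W X'' Gν (perWin d (N * L ^ (j + 1)))| :=
          (abs_sub _ _).trans (by gcongr; exact abs_add_le _ _)
      _ ≤ g * ((1 + 2 * d * Cfr) * dirL1 Y (periodBox (d := d) (N * L ^ (j + 1))))
          + τW * (2 * Λ * ((1 + 2 * d * Cfr) * dirL1 Y (periodBox (d := d) (N * L ^ (j + 1)))))
          + τW * (2 * (R + 2 * Λ) * (d * (Cfr * dirL1 Y (periodBox (d := d) (N * L ^ (j + 1)))))) := add_le_add (add_le_add ht1 ht2) ht3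
      _ = g'' * dirL1 Y (periodBox (d := d) (N * L ^ (j + 1))) := by rw [hg''def]; ring
  -- the one-term letter on Bałaban's slice for `X''`, and the pure gauge's own curl
  have hcurl'' : ‖curlAt W X'' z μ' ν'‖ ≤ KB * g'' := hB X'' hX''s hX''P hQ'' hG'' g'' hg''0 hfun'' z μ' ν' hne
  have hcurlG : ‖curlAt W G z μ' ν'‖ ≤ 2 * x * Λ := by
    rw [hGdef]
    exact (norm_curlAt_gaugeDir_le hWu hWx lam z hne).trans (mul_le_mul_of_nonneg_left (hlamB z) (by positivity))
  have hcurlX : curlAt W X z μ' ν' = curlAt W X'' z μ' ν' - curlAt W G z μ' ν' := by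
    have h : curlAt W X'' z μ' ν' = curlAt W X z μ' ν' + curlAt W G z μ' ν' := by
      have hsplitX : X'' = X + G := by funext y κ; simp [hX''def]
      rw [hsplitX, curlAt_add]
    rw [h, add_sub_cancel_right]
  rw [hcurlX]
  calc ‖curlAt W X'' z μ' ν' - curlAt W G z μ' ν'‖ ≤ ‖curlAt W X'' z μ' ν'‖ + ‖curlAt W G z μ' ν'‖ := norm_sub_le _ _
    _ ≤ KB * g'' + 2 * x * Λ := add_le_add hcurl'' hcurlG
    _ = (KB * (1 + 2 * d * Cfr)) * g + (2 * d * KB * Cfr * τW + (2 * KB * τW * (1 + 4 * d * Cfr) + 2 * x) * CR) * R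
          + ((2 * KB * τW * (1 + 4 * d * Cfr) + 2 * x) * CD) * D + ((2 * KB * τW * (1 + 4 * d * Cfr) + 2 * x) * CΞ) * Ξ := by
        rw [hg''def, hΛdef]; ring

end

end Summit.QuantumFields.BalabanUV.T4Continuum.NE7SliceLetterBalabanGauge
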